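import Mathlib
import Summits.Ventures.HodgeRepro2.T6A1DictRat
import Summits.Ventures.HodgeRepro2.T6A1EigenBasis

/-!
# T6A1DictHodge — the A1 dictionary with its Hodge types, from the four factors (Lemma A0.5 on the host)

Tier-6 sub-goal A1, Layer III (owner t6-p1, gen 2; STATUS ll. 5135 (3), 5218). `T6A1DictRat` built a
`K`-equivariant identification `φ₁` of the model's `H¹(B, ℂ) = Fin 4 → K ⊗ ℂ` with a host-shaped carrier from
ONE rational structure; it says nothing about Hodge types, and — as STATUS l. 5218 shows — no identification
can, unless the carrier remembers the FOUR FACTORS `A_i` of the corner product. This file takes the factors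
as data: four `act`-stable subspaces `W i` (the images `pr_i^* H¹(A_i, ℂ)`) decomposing the carrier
(`DirectSum.IsInternal`), each with its own rational structure (`T6A1DictRat.RatStructure` on `W i`, of
`ℂ`-dimension `6 = 2 · dim A_i`), the `(1,0)`- and `(0,1)`-parts `h10V`, `h01V` of the carrier
(`ℂ`-dimension `12 = dim B`), and Lemma A0.5 in the host's words (`eig_h10` / `eig_h01`: inside `W i` the
`σ`-eigenvectors are of type `(1,0)` when `σ ∈ T i` and of type `(0,1)` when `σ ∉ T i` — Shimura 1998 Thm 1
/ the host's `CMVariety.type_spec` for the factor, with `(A i).type = F.T i`). Output: `phi : H1C K ≃ₗ[ℂ] V1`,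
`K`-equivariant (`phi_act`), sending the `i`-th vertex's `K ⊗ ℂ` onto `W i` (`phi_single_mem`), the
model's `H^{1,0}(B) = h10 F` ONTO `h10V` and `H^{0,1}(B) = h01 F` onto `h01V` (`map_h10`, `map_h01`: the
`≤` by Lemma A0.5, the equality by the dimension count `12 = 12`, `T6A1EigenBasis`), and the rational classes
of the carrier (given factor-wise, `ratl1_mem`) as `phi` of the model's rational classes
(`exists_phi_h1ToC_eq`); `identOfFactors` packages it as the `H1Ident` of `T6A1Dict` through `ofLange`.
§8(d): uses an L-value-free non-vanishing device: NO.
-/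

namespace Summit.Ventures.HodgeRepro2.T6.A1DictHodge

open scoped TensorProduct
open A1Dict A1DictRat A2Model A3Model A1EigenBasis

section factors

variable {K : Type*} [Field K] [NumberField K]
variable {V1 : Type*} [AddCommGroup V1] [Module ℂ V1] [Module ℚ V1] [IsScalarTower ℚ ℂ V1]

/-- The action restricted to an `act`-stable subspace `W`, as a ring homomorphism `K →+* End_ℂ(W)`. -/
noncomputable def actW (act : K →+* Module.End ℂ V1) (W : Submodule ℂ V1)
    (hW : ∀ (x : K), ∀ v ∈ W, act x v ∈ W) : K →+* Module.End ℂ W where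
  toFun x := (act x).restrict fun v hv => hW x v hv
  map_one' := by ext v; simp
  map_mul' x y := by ext v; simp
  map_zero' := by ext v; simp
  map_add' x y := by ext v; simp

omit [NumberField K] [Module ℚ V1] [IsScalarTower ℚ ℂ V1] in
/-- `actW` on a vector of `W`, in `V1`. -/
@[simp] theorem coe_actW (act : K →+* Module.End ℂ V1) (W : Submodule ℂ V1)
    (hW : ∀ (x : K), ∀ v ∈ W, act x v ∈ W) (x : K) (v : W) :
    (actW act W hW x v : V1) = act x v := rfl

/-- THE FACTOR DATA of a corner product on a host-shaped carrier: four `act`-stable subspaces `W i`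
decomposing the carrier (`pr_i^* H¹(A_i)`), a rational structure on each (`T6A1DictRat.RatStructure`),
the Hodge pieces `h10V`, `h01V` with Lemma A0.5 (`eig_h10` / `eig_h01`) and the dimension counts, and the
rational classes `ratl1` of the carrier given factor-wise. -/
structure FactorIdent (F : FaceSetting K) (act : K →+* Module.End ℂ V1) (h10V h01V : Submodule ℂ V1)
    (ratl1 : V1 → Prop) where
  /-- the image of `H¹(A_i, ℂ)` -/
  W : Fin 4 → Submodule ℂ V1
  /-- `H¹(B, ℂ) = ⊕_i pr_i^* H¹(A_i, ℂ)` -/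
  isInternal : DirectSum.IsInternal W
  /-- the `K`-action preserves each factor -/
  act_W : ∀ (x : K) (i : Fin 4), ∀ v ∈ W i, act x v ∈ W i
  /-- the rational structure of each factor -/
  rs : ∀ i : Fin 4, RatStructure (actW act (W i) (act_W · i))
  /-- `dim_ℂ H¹(A_i, ℂ) = 2 · 3` -/
  finrank_W : ∀ i, Module.finrank ℂ (W i) = 6
  /-- Lemma A0.5, `(1,0)`: inside `W i`, a `σ`-eigenvector with `σ ∈ T i` is of type `(1,0)` -/
  eig_h10 : ∀ (i : Fin 4) (σ : K →+* ℂ), σ ∈ F.T i → ∀ v ∈ W i, v ∈ eigSub act σ → v ∈ h10V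
  /-- Lemma A0.5, `(0,1)`: inside `W i`, a `σ`-eigenvector with `σ ∉ T i` is of type `(0,1)` -/
  eig_h01 : ∀ (i : Fin 4) (σ : K →+* ℂ), σ ∉ F.T i → ∀ v ∈ W i, v ∈ eigSub act σ → v ∈ h01V
  /-- `h^{1,0}(B) = dim B = 12` -/
  finrank_h10V : Module.finrank ℂ h10V = 12
  /-- `h^{0,1}(B) = 12` -/
  finrank_h01V : Module.finrank ℂ h01V = 12
  /-- a rational class of the carrier is a sum of rational classes of the factors -/
  ratl1_mem : ∀ r : V1, ratl1 r → ∃ f : ∀ i, W i, (∀ i, f i ∈ (rs i).R) ∧ r = ∑ i, (f i : V1)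
  /-- a rational class of a factor is a rational class of the carrier -/
  ratl1_rs : ∀ (i : Fin 4) (r : W i), r ∈ (rs i).R → ratl1 r
  /-- rational classes are closed under sums -/
  ratl1_add : ∀ r s : V1, ratl1 r → ratl1 s → ratl1 (r + s)
  /-- `0` is rational -/
  ratl1_zero : ratl1 0

namespace FactorIdent

variable {F : FaceSetting K} {act : K →+* Module.End ℂ V1} {h10V h01V : Submodule ℂ V1}
  {ratl1 : V1 → Prop} (I : FactorIdent F act h10V h01V ratl1)

/-! ## 1. Each factor's rational classes form a `K`-line: `K ≃ₗ[K] R_i` -/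

/-- `dim_K R_i = 1`. -/
theorem finrank_K_rs (hdeg : Module.finrank ℚ K = 6) (i : Fin 4) :
    Module.finrank K (I.rs i).R = 1 := by
  have h := Module.finrank_mul_finrank ℚ K (I.rs i).R
  rw [(I.rs i).finrank_R, I.finrank_W i, hdeg] at h
  omega

/-- `R_i` is a finite-dimensional `K`-space. -/
theorem finite_K_rs (hdeg : Module.finrank ℚ K = 6) (i : Fin 4) : Module.Finite K (I.rs i).R :=
  Module.finite_of_finrank_pos (by rw [I.finrank_K_rs hdeg i]; norm_num)

/-- `K ≃ₗ[K] R_i` (a generator of the rational classes of the factor as a `K`-line). -/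
noncomputable def psi1 (hdeg : Module.finrank ℚ K = 6) (i : Fin 4) : K ≃ₗ[K] (I.rs i).R :=
  haveI := I.finite_K_rs hdeg i
  LinearEquiv.ofFinrankEq K (I.rs i).R (by rw [Module.finrank_self, I.finrank_K_rs hdeg i])

/-- `K ≃ₗ[ℚ] R_i`. -/
noncomputable def psi1Q (hdeg : Module.finrank ℚ K = 6) (i : Fin 4) : K ≃ₗ[ℚ] (I.rs i).R :=
  (I.psi1 hdeg i).restrictScalars ℚ

/-- THE FACTOR IDENTIFICATION `K ⊗ ℂ ≃ₗ[ℂ] W_i`. -/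
noncomputable def phiW (hdeg : Module.finrank ℚ K = 6) (i : Fin 4) : KC K ≃ₗ[ℂ] I.W i :=
  ((I.psi1Q hdeg i).baseChange ℚ ℂ K (I.rs i).R).trans (I.rs i).toVEquiv

/-- `phiW (c ⊗ k) = c • psi1 k`. -/
theorem phiW_tmul (hdeg : Module.finrank ℚ K = 6) (i : Fin 4) (c : ℂ) (k : K) :
    (I.phiW hdeg i (c ⊗ₜ[ℚ] k) : V1) = c • (I.psi1 hdeg i k : V1) := by
  simp [phiW, psi1Q]

/-- `phiW` intertwines `(1 ⊗ x) ·` with `act x`. -/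
theorem phiW_mul (hdeg : Module.finrank ℚ K = 6) (i : Fin 4) (x : K) (v : KC K) :
    (I.phiW hdeg i ((Algebra.TensorProduct.includeRight x : KC K) * v) : V1) =
      act x (I.phiW hdeg i v : V1) := by
  induction v using TensorProduct.induction_on with
  | zero => simp
  | tmul c k =>
    rw [Algebra.TensorProduct.includeRight_apply, Algebra.TensorProduct.tmul_mul_tmul, one_mul,
      phiW_tmul, phiW_tmul, ← smul_eq_mul, (I.psi1 hdeg i).map_smul, RatStructure.coe_smul, coe_actW,
      (act x).map_smul]
  | add a b ha hb => rw [mul_add, map_add, Submodule.coe_add, ha, hb, map_add, Submodule.coe_add, map_add]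

/-! ## 2. The identification `phi : H¹(B, ℂ)_model ≃ V1` -/

/-- THE IDENTIFICATION: `(v i)_i ↦ ∑_i phiW i (v i)`, an isomorphism by `isInternal`. -/
noncomputable def phi (hdeg : Module.finrank ℚ K = 6) : H1C K ≃ₗ[ℂ] V1 :=
  (LinearEquiv.piCongrRight fun i => I.phiW hdeg i).trans
    ((DirectSum.linearEquivFunOnFintype ℂ (Fin 4) fun i => I.W i).symm.trans
      (LinearEquiv.ofBijective (DirectSum.coeLinearMap I.W) I.isInternal))

/-- `phi v = ∑_i phiW i (v i)`. -/
theorem phi_apply (hdeg : Module.finrank ℚ K = 6) (v : H1C K) :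
    I.phi hdeg v = ∑ i, (I.phiW hdeg i (v i) : V1) := by
  have h : (LinearEquiv.piCongrRight fun i => I.phiW hdeg i) v = fun i => I.phiW hdeg i (v i) := rfl
  simp only [phi, LinearEquiv.trans_apply, LinearEquiv.ofBijective_apply, h]
  conv_lhs => rw [← Finset.univ_sum_single (fun i => I.phiW hdeg i (v i))]
  rw [map_sum, map_sum]
  simp only [DirectSum.linearEquivFunOnFintype_symm_single, DirectSum.coeLinearMap_lof]

/-- `phi` on a single vertex: `phiW i`. -/
theorem phi_single (hdeg : Module.finrank ℚ K = 6) (i : Fin 4) (e : KC K) :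
    I.phi hdeg (LinearMap.single ℂ (fun _ : Fin 4 => KC K) i e) = (I.phiW hdeg i e : V1) := by
  rw [phi_apply, Finset.sum_eq_single i]
  · simp
  · intro j _ hji
    simp [LinearMap.single_apply, hji]
  · intro h; exact absurd (Finset.mem_univ i) h

/-- `phi` sends the `i`-th vertex into `W i`. -/
theorem phi_single_mem (hdeg : Module.finrank ℚ K = 6) (i : Fin 4) (e : KC K) :
    I.phi hdeg (LinearMap.single ℂ (fun _ : Fin 4 => KC K) i e) ∈ I.W i := by
  rw [phi_single]; exact Subtype.mem _

/-- `phi` IS `K`-EQUIVARIANT. -/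
theorem phi_act (hdeg : Module.finrank ℚ K = 6) (x : K) (v : H1C K) :
    I.phi hdeg (actH1C K x v) = act x (I.phi hdeg v) := by
  rw [phi_apply, phi_apply, map_sum]
  refine Finset.sum_congr rfl fun i _ => ?_
  rw [actH1C_apply, phiW_mul]

/-! ## 3. The Hodge types: `phi (h10 F) = h10V`, `phi (h01 F) = h01V` (Lemma A0.5 + the dimension count) -/

/-- `phi` sends the eigenline `ℓ_{i,σ}` into the host's `σ`-eigenspace inside `W i`. -/
theorem map_eigenLine_le (hdeg : Module.finrank ℚ K = 6) (i : Fin 4) (σ : K →+* ℂ) :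
    (eigenLine K i σ).map (I.phi hdeg : H1C K →ₗ[ℂ] V1) ≤ eigSub act σ ⊓ I.W i := by
  intro w hw
  obtain ⟨v, hv, rfl⟩ := Submodule.mem_map.1 hw
  obtain ⟨e, he, rfl⟩ := Submodule.mem_map.1 hv
  refine Submodule.mem_inf.2 ⟨?_, I.phi_single_mem hdeg i e⟩
  rw [mem_eigSub]
  intro x
  rw [LinearEquiv.coe_coe, ← I.phi_act, ← map_smul]
  congr 1
  funext j
  simp only [actH1C_apply, LinearMap.single_apply, Pi.smul_apply]
  by_cases h : j = i
  · subst h; simp only [Pi.single_eq_same]; exact he x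
  · simp [Pi.single_eq_of_ne h]

/-- `phi (h10 F) ≤ h10V` (Lemma A0.5, `(1,0)`). -/
theorem map_h10_le (hdeg : Module.finrank ℚ K = 6) : (h10 F).map (I.phi hdeg : H1C K →ₗ[ℂ] V1) ≤ h10V := by
  unfold h10
  simp only [Submodule.map_iSup]
  refine iSup_le fun i => iSup_le fun σ => iSup_le fun hσ => ?_
  intro v hv
  obtain ⟨h1, h2⟩ := I.map_eigenLine_le hdeg i σ hv
  exact I.eig_h10 i σ hσ v h2 h1

/-- `phi (h01 F) ≤ h01V` (Lemma A0.5, `(0,1)`). -/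
theorem map_h01_le (hdeg : Module.finrank ℚ K = 6) : (h01 F).map (I.phi hdeg : H1C K →ₗ[ℂ] V1) ≤ h01V := by
  unfold h01
  simp only [Submodule.map_iSup]
  refine iSup_le fun i => iSup_le fun σ => iSup_le fun hσ => ?_
  intro v hv
  obtain ⟨h1, h2⟩ := I.map_eigenLine_le hdeg i σ hv
  exact I.eig_h01 i σ hσ v h2 h1

end FactorIdent

/-! ## 4. The dimension count on the model: `dim h10 F = dim h01 F = 12` (`T6A1EigenBasis`) -/

section count

variable (K)

/-- The model's `H^{1,0}` as the span of the eigenbasis vectors `e_{i,σ}` with `σ ∈ T i`. -/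
theorem h10_eq_span (F : FaceSetting K) (E : EigenBasis K) :
    h10 F = Submodule.span ℂ (Set.range (E.eB ∘ (Subtype.val : {p : Fin 4 × (K →+* ℂ) // p.2 ∈ F.T p.1} → _))) := by
  unfold h10
  simp only [E.eigen]
  apply le_antisymm
  · refine iSup_le fun i => iSup_le fun σ => iSup_le fun hσ => Submodule.span_le.2 ?_
    rintro _ rfl
    exact Submodule.subset_span ⟨⟨(i, σ), hσ⟩, rfl⟩
  · refine Submodule.span_le.2 ?_
    rintro _ ⟨⟨⟨i, σ⟩, hσ⟩, rfl⟩
    exact Submodule.mem_iSup_of_mem i (Submodule.mem_iSup_of_mem σ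
      (Submodule.mem_iSup_of_mem hσ (Submodule.subset_span rfl)))

/-- The model's `H^{0,1}` as the span of the eigenbasis vectors `e_{i,σ}` with `σ ∉ T i`. -/
theorem h01_eq_span (F : FaceSetting K) (E : EigenBasis K) :
    h01 F = Submodule.span ℂ (Set.range (E.eB ∘ (Subtype.val : {p : Fin 4 × (K →+* ℂ) // p.2 ∉ F.T p.1} → _))) := by
  unfold h01
  simp only [E.eigen]
  apply le_antisymm
  · refine iSup_le fun i => iSup_le fun σ => iSup_le fun hσ => Submodule.span_le.2 ?_
    rintro _ rfl
    exact Submodule.subset_span ⟨⟨(i, σ), hσ⟩, rfl⟩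
  · refine Submodule.span_le.2 ?_
    rintro _ ⟨⟨⟨i, σ⟩, hσ⟩, rfl⟩
    exact Submodule.mem_iSup_of_mem i (Submodule.mem_iSup_of_mem σ
      (Submodule.mem_iSup_of_mem hσ (Submodule.subset_span rfl)))

/-- `#{(i, σ) | σ ∈ T i} = 4 · 3 = 12`. -/
theorem card_h10_index (F : FaceSetting K) :
    Nat.card {p : Fin 4 × (K →+* ℂ) // p.2 ∈ F.T p.1} = 12 := by
  classical
  rw [Nat.card_eq_fintype_card,
    Fintype.card_congr (Equiv.subtypeProdEquivSigmaSubtype fun i σ => σ ∈ F.T i),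
    Fintype.card_sigma]
  have h : ∀ i : Fin 4, Fintype.card {σ : K →+* ℂ // σ ∈ F.T i} = 3 := fun i => by
    rw [← Nat.card_eq_fintype_card]
    exact card_cmType F.deg6 (F.face.1 i)
  simp [h]

/-- `#{(i, σ) | σ ∉ T i} = 4 · 3 = 12`. -/
theorem card_h01_index (F : FaceSetting K) :
    Nat.card {p : Fin 4 × (K →+* ℂ) // p.2 ∉ F.T p.1} = 12 := by
  classical
  rw [Nat.card_eq_fintype_card,
    Fintype.card_congr (Equiv.subtypeProdEquivSigmaSubtype fun i σ => σ ∉ F.T i),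
    Fintype.card_sigma]
  have hcard : Fintype.card (K →+* ℂ) = 6 := by
    rw [NumberField.Embeddings.card K ℂ, F.deg6]
  have h : ∀ i : Fin 4, Fintype.card {σ : K →+* ℂ // σ ∉ F.T i} = 3 := fun i => by
    have h3 : Fintype.card {σ : K →+* ℂ // σ ∈ F.T i} = 3 := by
      rw [← Nat.card_eq_fintype_card]
      exact card_cmType F.deg6 (F.face.1 i)
    rw [Fintype.card_subtype_compl, hcard, h3]
  simp [h]

/-- `dim_ℂ H^{1,0}(B) = 12`. -/
theorem finrank_h10 (F : FaceSetting K) : Module.finrank ℂ (h10 F) = 12 := by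
  classical
  obtain ⟨E, -⟩ := exists_eigenBasis K F
  rw [h10_eq_span K F E, finrank_span_eq_card (E.eB.linearIndependent.comp _ Subtype.val_injective),
    ← Nat.card_eq_fintype_card, card_h10_index]

/-- `dim_ℂ H^{0,1}(B) = 12`. -/
theorem finrank_h01 (F : FaceSetting K) : Module.finrank ℂ (h01 F) = 12 := by
  classical
  obtain ⟨E, -⟩ := exists_eigenBasis K F
  rw [h01_eq_span K F E, finrank_span_eq_card (E.eB.linearIndependent.comp _ Subtype.val_injective),
    ← Nat.card_eq_fintype_card, card_h01_index]

end count

namespace FactorIdent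

variable {F : FaceSetting K} {act : K →+* Module.End ℂ V1} {h10V h01V : Submodule ℂ V1}
  {ratl1 : V1 → Prop} (I : FactorIdent F act h10V h01V ratl1)

/-- THE HODGE DICTIONARY, `(1,0)`: `phi (H^{1,0}(B)) = h10V`. -/
theorem map_h10 (hdeg : Module.finrank ℚ K = 6) : (h10 F).map (I.phi hdeg : H1C K →ₗ[ℂ] V1) = h10V := by
  haveI : FiniteDimensional ℂ h10V := Module.finite_of_finrank_pos (by rw [I.finrank_h10V]; norm_num)
  refine Submodule.eq_of_le_of_finrank_eq (I.map_h10_le hdeg) ?_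
  rw [LinearEquiv.finrank_map_eq, finrank_h10, I.finrank_h10V]

/-- THE HODGE DICTIONARY, `(0,1)`: `phi (H^{0,1}(B)) = h01V`. -/
theorem map_h01 (hdeg : Module.finrank ℚ K = 6) : (h01 F).map (I.phi hdeg : H1C K →ₗ[ℂ] V1) = h01V := by
  haveI : FiniteDimensional ℂ h01V := Module.finite_of_finrank_pos (by rw [I.finrank_h01V]; norm_num)
  refine Submodule.eq_of_le_of_finrank_eq (I.map_h01_le hdeg) ?_
  rw [LinearEquiv.finrank_map_eq, finrank_h01, I.finrank_h01V]

/-! ## 5. The rational classes -/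

/-- `phi` on a rational model class: the sum of the factor generators. -/
theorem phi_h1ToC (hdeg : Module.finrank ℚ K = 6) (w : H1 K) :
    I.phi hdeg (h1ToC K w) = ∑ i, (I.psi1 hdeg i (w i) : V1) := by
  rw [phi_apply]
  refine Finset.sum_congr rfl fun i _ => ?_
  have : h1ToC K w i = (1 : ℂ) ⊗ₜ[ℚ] w i := rfl
  rw [this, phiW_tmul, one_smul]

/-- `phi` of a rational model class is a rational class of the carrier. -/
theorem ratl1_phi_h1ToC (hdeg : Module.finrank ℚ K = 6) (w : H1 K) : ratl1 (I.phi hdeg (h1ToC K w)) := by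
  rw [phi_h1ToC]
  refine Finset.sum_induction _ (fun a => ratl1 a) (fun a b ha hb => I.ratl1_add a b ha hb) I.ratl1_zero
    fun i _ => I.ratl1_rs i _ (Subtype.mem _)

/-- Every rational class of the carrier is `phi` of a rational model class. -/
theorem exists_phi_h1ToC_eq (hdeg : Module.finrank ℚ K = 6) {r : V1} (hr : ratl1 r) :
    ∃ w : H1 K, I.phi hdeg (h1ToC K w) = r := by
  obtain ⟨f, hf, rfl⟩ := I.ratl1_mem r hr
  refine ⟨fun i => (I.psi1 hdeg i).symm ⟨f i, hf i⟩, ?_⟩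
  rw [phi_h1ToC]
  refine Finset.sum_congr rfl fun i _ => ?_
  rw [LinearEquiv.apply_symm_apply]

/-- THE RATIONAL CLASSES OF THE CARRIER are exactly `phi` of the model's rational classes. -/
theorem ratl1_iff (hdeg : Module.finrank ℚ K = 6) (r : V1) :
    ratl1 r ↔ ∃ w : H1 K, I.phi hdeg (h1ToC K w) = r :=
  ⟨fun hr => I.exists_phi_h1ToC_eq hdeg hr, fun ⟨w, hw⟩ => hw ▸ I.ratl1_phi_h1ToC hdeg w⟩

/-- The host-level degree-4 rationality clause gives the clause of `T6A1Dict.ofLange` for `phi`. -/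
theorem hrat_of {V4 : Type*} [AddCommGroup V4] [Module ℂ V4] {cup4 : V1 → V1 → V1 → V1 → V4}
    {ratl4 : V4 → Prop} (hdeg : Module.finrank ℚ K = 6)
    (hrat4 : ∀ c : V4, ratl4 c → ∃ (n : ℕ) (q : Fin n → ℚ) (r : Fin n → Fin 4 → V1),
      (∀ i j, ratl1 (r i j)) ∧ c = ∑ i, (q i : ℂ) • cup4 (r i 0) (r i 1) (r i 2) (r i 3)) :
    ∀ c : V4, ratl4 c → ∃ (n : ℕ) (q : Fin n → ℚ) (w : Fin n → Fin 4 → H1 K),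
      c = ∑ i, (q i : ℂ) • cup4 (I.phi hdeg (h1ToC K (w i 0))) (I.phi hdeg (h1ToC K (w i 1)))
        (I.phi hdeg (h1ToC K (w i 2))) (I.phi hdeg (h1ToC K (w i 3))) := by
  intro c hc
  obtain ⟨n, q, r, hr, rfl⟩ := hrat4 c hc
  choose w hw using fun i j => I.exists_phi_h1ToC_eq hdeg (hr i j)
  refine ⟨n, q, w, Finset.sum_congr rfl fun i _ => ?_⟩
  rw [hw i 0, hw i 1, hw i 2, hw i 3]

/-- THE `H1Ident` OF `T6A1Dict` FROM THE FACTOR DATA (with its Hodge types available through `map_h10` /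
`map_h01`): `phi`, Lange's `e : ⋀⁴ V1 ≃ V4` on `exteriorPower.ιMulti`, and the degree-4 rationality
clause. -/
noncomputable def identOfFactors {V4 : Type*} [AddCommGroup V4] [Module ℂ V4]
    {cup4 : V1 → V1 → V1 → V1 → V4} {ratl4 : V4 → Prop} (hdeg : Module.finrank ℚ K = 6)
    (e : ⋀[ℂ]^4 V1 ≃ₗ[ℂ] V4)
    (he : ∀ v : Fin 4 → V1, e (exteriorPower.ιMulti ℂ 4 v) = cup4 (v 0) (v 1) (v 2) (v 3))
    (hrat4 : ∀ c : V4, ratl4 c → ∃ (n : ℕ) (q : Fin n → ℚ) (r : Fin n → Fin 4 → V1),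
      (∀ i j, ratl1 (r i j)) ∧ c = ∑ i, (q i : ℂ) • cup4 (r i 0) (r i 1) (r i 2) (r i 3)) :
    H1Ident K V1 V4 act cup4 ratl4 :=
  ofLange (I.phi hdeg) (I.phi_act hdeg) e he (I.hrat_of hdeg hrat4)

/-- The `φ₁` of `identOfFactors` is `phi`. -/
theorem identOfFactors_φ₁ {V4 : Type*} [AddCommGroup V4] [Module ℂ V4]
    {cup4 : V1 → V1 → V1 → V1 → V4} {ratl4 : V4 → Prop} (hdeg : Module.finrank ℚ K = 6)
    (e : ⋀[ℂ]^4 V1 ≃ₗ[ℂ] V4)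
    (he : ∀ v : Fin 4 → V1, e (exteriorPower.ιMulti ℂ 4 v) = cup4 (v 0) (v 1) (v 2) (v 3))
    (hrat4 : ∀ c : V4, ratl4 c → ∃ (n : ℕ) (q : Fin n → ℚ) (r : Fin n → Fin 4 → V1),
      (∀ i j, ratl1 (r i j)) ∧ c = ∑ i, (q i : ℂ) • cup4 (r i 0) (r i 1) (r i 2) (r i 3)) :
    (I.identOfFactors hdeg e he hrat4).φ₁ = I.phi hdeg := rfl

end FactorIdent

end factors

end Summit.Ventures.HodgeRepro2.T6.A1DictHodge
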